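import Summits.ValiantsHypothesis.ValiantsHypothesis.Theorems.SymmetroidPencilBasics
import Summits.ValiantsHypothesis.ValiantsHypothesis.Theorems.LacunarySymmetroidMatrixDescartesStubReverse

/-!
# `MatrixDescartes`, line `Lift` — negative calibration: no K-free law in the DEFINITE two-sided sector either;
# a counterexample to the Cameron–Psarrakos matrix Descartes conjecture at `n = 2`, `α(P) = 2`

Crux `stmt-ValiantsHypothesis-18050` (`Theses.LacunarySymmetroid.MatrixDescartes`), open stub `stub_twoSided`
(pencils `X^e • J + ∑ₖ X^{dₖ} • Pₖ`, `Pₖ ⪰ 0` on both sides of the pivot `e`, one constant symmetric `J`).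
After the rank-one rung died (`not_rankOneLaw_two`, `LacunarySymmetroidMatrixDescartesRankOneWitness.lean`) the
next K-free candidate was the DEFINITE rung: `J ≺ 0 ⇒ Z₊ ≤ 2·card ι` (tight for commuting `Pₖ`; every
negative definite `J` is congruent to `−I`).  It is exactly the case `α(P) = 2` of the generalized Descartes
rule `z₊(P) ≤ n·α(P)` of Cameron–Psarrakos [On Descartes' rule of signs for matrix polynomials, Operators and
Matrices 13 (2019) 643–652, doi:10.7153/oam-2019-13-48, display (6)], proved there for hyperbolic `P`, for
congruence-diagonalizable `P` and for degree `≤ 3` (Thm 3, Prop. 4, Thm 7; Lemma 6 gives `α ∈ {0, 1, m}` for the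
whole class `S` of self-adjoint matrix polynomials with definite-or-null coefficients) and CONJECTURED for all of
`S` (§3, §5).

This file certifies in the kernel that the conjecture is FALSE at its first open case: the `2 × 2` real symmetric
matrix polynomial `P(t) = C₀ + t⁶C₆ + t⁷C₇ + t⁸C₈ + t¹⁵C₁₅` with POSITIVE DEFINITE `C₀, C₆, C₈, C₁₅` and
NEGATIVE DEFINITE `C₇` (two sign alternations, `n·α(P) = 4`) has `det P` alternating in sign at
`1/8 < 1/4 < 1/2 < 1 < 2 < 4 < 8`, hence at least `6 > 4` distinct positive real eigenvalues
(`six_le_card_posRoots_P₂₆`, `cameronPsarrakos_counterexample`).  In the crux's currency (`J = C₇ ≺ 0`, pivot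
`e = 7`, PD terms at exponents `0, 6, 8, 15`): `not_definiteLaw_two`.  The witness is the rank-one witness of
`…RankOneWitness` with the negative letter moved to its own degree and every coefficient made definite by
`± 10⁻⁶·I` (scaled by `10⁶` to integer entries): `Cₐ = 10⁶·Σ vₖvₖᵀ + I`, `C₇ = −(10⁶·wwᵀ + I)`,
`v = ((16,−74), (−74,282), (−17,−19), (−83,81), (−48,13))` at degrees `(0, 6, 8, 8, 15)`, `w = (0, 200)`.
Consequence for the line: the two-sided core has no K-free sector beyond the one-sided first rung (= the case
`α = 1`, which `firstRung_oneSided` proves even with an indefinite extreme coefficient).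

[cite: CameronPsarrakos2019, display (6), §3 ("We conjecture that (6), in fact, holds for all matrix polynomials
in S"), §5]  Elementary; the sign pattern is a `norm_num` certificate at rational points.
-/

-- `Summit.ValiantsHypothesis.ValiantsHypothesis.…` repeats a component by the D-0017 layout
-- (single-conjunct summit), which the `dupNamespace` linter flags; the name is mandated.
set_option linter.dupNamespace false

namespace Summit.ValiantsHypothesis.ValiantsHypothesis.Theorems.LacunarySymmetroidMatrixDescartes

open Summit.ValiantsHypothesis.ValiantsHypothesis.Theorems.SymmetroidDescartes
  (le_card_posRoots_of_alternating)
open scoped BigOperators Matrix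
open Polynomial

namespace DefiniteWitness

/-- the five integer vectors `vₖ` (the rank-one witness, integerised at scale 200) -/
def V₂₆ : Fin 5 → Fin 2 → ℝ := ![![16, -74], ![-74, 282], ![-17, -19], ![-83, 81], ![-48, 13]]

/-- the vector `w = (0, 200)` of the negative letter -/
def w₂₆ : Fin 2 → ℝ := ![0, 200]

/-- the four POSITIVE DEFINITE coefficients `10⁶·Σ_{dₖ = deg} vₖvₖᵀ + I` at degrees `0, 6, 8, 15`
(the degree-8 coefficient carries the two vectors `v₂, v₃`) -/
def Cpos₂₆ : Fin 4 → Matrix (Fin 2) (Fin 2) ℝ :=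
  ![(1000000 : ℝ) • Matrix.vecMulVec (V₂₆ 0) (V₂₆ 0) + 1,
    (1000000 : ℝ) • Matrix.vecMulVec (V₂₆ 1) (V₂₆ 1) + 1,
    (1000000 : ℝ) • (Matrix.vecMulVec (V₂₆ 2) (V₂₆ 2) + Matrix.vecMulVec (V₂₆ 3) (V₂₆ 3)) + 1,
    (1000000 : ℝ) • Matrix.vecMulVec (V₂₆ 4) (V₂₆ 4) + 1]

/-- their degrees `(0, 6, 8, 15)` -/
def dpos₂₆ : Fin 4 → ℕ := ![0, 6, 8, 15]

/-- the NEGATIVE DEFINITE coefficient `J = −(10⁶·wwᵀ + I)` at the pivot degree `e = 7` -/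
def J₂₆ : Matrix (Fin 2) (Fin 2) ℝ := -((1000000 : ℝ) • Matrix.vecMulVec w₂₆ w₂₆ + 1)

/-- the pivot degree `e = 7` -/
def e₂₆ : ℕ := 7

/-- the witness `P(X) = X^7 • J + ∑ₖ X^{dₖ} • Cₖ`, in the currency of `stub_twoSided` -/
noncomputable def P₂₆ : Matrix (Fin 2) (Fin 2) ℝ[X] :=
  ((X : ℝ[X]) ^ e₂₆) • J₂₆.map Polynomial.C + ∑ k, ((X : ℝ[X]) ^ dpos₂₆ k) • (Cpos₂₆ k).map Polynomial.C

/-- `vvᵀ` is positive semidefinite over `ℝ` -/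
theorem posSemidef_vecMulVec_self (v : Fin 2 → ℝ) : (Matrix.vecMulVec v v).PosSemidef := by
  have h := Matrix.posSemidef_vecMulVec_self_star (R := ℝ) v
  rwa [star_trivial] at h

/-- every `Cₖ` is positive definite -/
theorem Cpos₂₆_posDef (k : Fin 4) : (Cpos₂₆ k).PosDef := by
  have h1 : ∀ v : Fin 2 → ℝ, ((1000000 : ℝ) • Matrix.vecMulVec v v + 1).PosDef := fun v =>
    Matrix.PosDef.posSemidef_add
      ((posSemidef_vecMulVec_self v).smul (by norm_num : (0 : ℝ) ≤ 1000000)) Matrix.PosDef.one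
  have h2 : ∀ v v' : Fin 2 → ℝ,
      ((1000000 : ℝ) • (Matrix.vecMulVec v v + Matrix.vecMulVec v' v') + 1).PosDef := fun v v' =>
    Matrix.PosDef.posSemidef_add
      (((posSemidef_vecMulVec_self v).add (posSemidef_vecMulVec_self v')).smul
        (by norm_num : (0 : ℝ) ≤ 1000000)) Matrix.PosDef.one
  fin_cases k
  · exact h1 _
  · exact h1 _
  · exact h2 _ _
  · exact h1 _

/-- `J` is negative definite (`−J ≻ 0`) -/
theorem neg_J₂₆_posDef : (-J₂₆).PosDef := by
  unfold J₂₆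
  rw [neg_neg]
  exact Matrix.PosDef.posSemidef_add
    ((posSemidef_vecMulVec_self w₂₆).smul (by norm_num : (0 : ℝ) ≤ 1000000)) Matrix.PosDef.one

/-- `J` is symmetric -/
theorem J₂₆_isSymm : J₂₆.IsSymm := by
  unfold Matrix.IsSymm J₂₆ w₂₆
  ext i j
  fin_cases i <;> fin_cases j <;> simp

/-- every `Cₖ` is positive semidefinite (for the `stub_twoSided` currency) -/
theorem Cpos₂₆_posSemidef (k : Fin 4) : (Cpos₂₆ k).PosSemidef := (Cpos₂₆_posDef k).posSemidef

/-- the witness is two-sided: PD degrees on both sides of the pivot -/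
theorem twoSided₂₆ : (∃ k, dpos₂₆ k < e₂₆) ∧ (∃ k, e₂₆ < dpos₂₆ k) :=
  ⟨⟨0, by simp [dpos₂₆, e₂₆]⟩, ⟨3, by simp [dpos₂₆, e₂₆]⟩⟩

/-- `det P(t)` in closed form -/
theorem eval_det_P₂₆ (t : ℝ) :
    (P₂₆.det).eval t =
      (256000001 + 5476000001 * t ^ 6 - t ^ 7 + 7178000001 * t ^ 8 + 2304000001 * t ^ 15) *
          (5476000001 + 79524000001 * t ^ 6 - 40000000001 * t ^ 7 + 6922000001 * t ^ 8 + 169000001 * t ^ 15) -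
        (-1184000000 - 20868000000 * t ^ 6 - 6400000000 * t ^ 8 - 624000000 * t ^ 15) ^ 2 := by
  unfold P₂₆
  rw [StubReverse.eval_det_pencil]
  simp [Matrix.det_fin_two, Fin.sum_univ_four, Cpos₂₆, V₂₆, J₂₆, w₂₆, dpos₂₆, e₂₆]
  ring

/-- seven positive dyadic test points -/
noncomputable def τ₂₆ : Fin 7 → ℝ := ![1/8, 1/4, 1/2, 1, 2, 4, 8]

/-- the test points increase -/
theorem τ₂₆_strictMono : StrictMono τ₂₆ := by
  refine Fin.strictMono_iff_lt_succ.2 fun j => ?_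
  fin_cases j <;> simp [τ₂₆] <;> norm_num

/-- the test points are positive -/
theorem τ₂₆_pos (j : Fin 7) : 0 < τ₂₆ j := by
  fin_cases j <;> simp [τ₂₆]

/-- `det P` alternates in sign along the test points (signs `+,−,+,−,+,−,+`; `norm_num` certificate) -/
theorem alt₂₆ (j : Fin 6) :
    (P₂₆.det).eval (τ₂₆ j.castSucc) * (P₂₆.det).eval (τ₂₆ j.succ) < 0 := by
  fin_cases j <;> simp only [eval_det_P₂₆, τ₂₆] <;> simp <;> norm_num

/-- **`Z₊ ≥ 6`** for the definite two-sided `2 × 2` witness. -/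
theorem six_le_card_posRoots_P₂₆ :
    6 ≤ (P₂₆.det.roots.toFinset.filter (fun t => 0 < t)).card :=
  le_card_posRoots_of_alternating _ 6 τ₂₆ τ₂₆_strictMono τ₂₆_pos alt₂₆

end DefiniteWitness

open DefiniteWitness

/-- **The definite rung is false at `n = 2`.**  It is NOT true that every two-sided pencil
`X^e • J + ∑ₖ X^{dₖ} • Pₖ` with `J` NEGATIVE DEFINITE and all `Pₖ` POSITIVE DEFINITE (`2 × 2`, four terms) has at
most `2 · 2` distinct positive zeros of its determinant: the witness `P₂₆` has at least `6`. -/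
theorem not_definiteLaw_two : ¬ ∀ (e : ℕ) (d : Fin 4 → ℕ) (J : Matrix (Fin 2) (Fin 2) ℝ) (P : Fin 4 → Matrix (Fin 2) (Fin 2) ℝ), (-J).PosDef → (∀ k, (P k).PosDef) → ((Matrix.det (((Polynomial.X : Polynomial ℝ) ^ e) • J.map Polynomial.C + ∑ k, ((Polynomial.X : Polynomial ℝ) ^ d k) • (P k).map Polynomial.C)).roots.toFinset.filter (fun t => 0 < t)).card ≤ 2 * 2 := by
  intro h
  have h6 := six_le_card_posRoots_P₂₆.trans (h e₂₆ dpos₂₆ J₂₆ Cpos₂₆ neg_J₂₆_posDef Cpos₂₆_posDef)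
  omega

/-- **Counterexample to the Cameron–Psarrakos conjecture** [On Descartes' rule of signs for matrix
polynomials, Oper. Matrices 13 (2019), display (6): `z₊(P) ≤ n·α(P)` for every self-adjoint matrix polynomial
whose coefficients are positive definite, negative definite or null].  The `2 × 2` real symmetric matrix
polynomial `P(t) = C₀ + t⁶C₆ + t⁷C₇ + t⁸C₈ + t¹⁵C₁₅` below has `C₀, C₆, C₈, C₁₅ ≻ 0` and `C₇ ≺ 0` — so `α(P) = 2`
sign alternations and `n·α(P) = 4` — yet `det P` has at least `6` distinct positive real roots, i.e. `P` has at
least `6 > 4` positive real eigenvalues. -/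
theorem cameronPsarrakos_counterexample :
    ∃ (C₀ C₆ C₇ C₈ C₁₅ : Matrix (Fin 2) (Fin 2) ℝ),
      C₀.PosDef ∧ C₆.PosDef ∧ (-C₇).PosDef ∧ C₈.PosDef ∧ C₁₅.PosDef ∧
        2 * 2 < ((Matrix.det (C₀.map Polynomial.C + ((X : ℝ[X]) ^ 6) • C₆.map Polynomial.C
            + ((X : ℝ[X]) ^ 7) • C₇.map Polynomial.C + ((X : ℝ[X]) ^ 8) • C₈.map Polynomial.C
            + ((X : ℝ[X]) ^ 15) • C₁₅.map Polynomial.C)).roots.toFinset.filter (fun t => 0 < t)).card := by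
  refine ⟨Cpos₂₆ 0, Cpos₂₆ 1, J₂₆, Cpos₂₆ 2, Cpos₂₆ 3, Cpos₂₆_posDef 0, Cpos₂₆_posDef 1, neg_J₂₆_posDef,
    Cpos₂₆_posDef 2, Cpos₂₆_posDef 3, ?_⟩
  have hP : (Cpos₂₆ 0).map Polynomial.C + ((X : ℝ[X]) ^ 6) • (Cpos₂₆ 1).map Polynomial.C
      + ((X : ℝ[X]) ^ 7) • J₂₆.map Polynomial.C + ((X : ℝ[X]) ^ 8) • (Cpos₂₆ 2).map Polynomial.C
      + ((X : ℝ[X]) ^ 15) • (Cpos₂₆ 3).map Polynomial.C = P₂₆ := by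
    unfold P₂₆
    simp only [Fin.sum_univ_four, dpos₂₆, e₂₆]
    simp
    abel
  rw [hP]
  exact lt_of_lt_of_le (by norm_num) six_le_card_posRoots_P₂₆

end Summit.ValiantsHypothesis.ValiantsHypothesis.Theorems.LacunarySymmetroidMatrixDescartes
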